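import Summits.QuantumFields.BalabanUV.T4Continuum.Support.InsertionLinearClassLoc

/-!
# InsertionLinearRateLoc — route P2's END with the linear-class insertion binders read PER READ-OUT (ruling R22): W3 from
# `AgeBudgetLoc`, W4 from `BaseRate ∧ VecRateLoc`, along a norming family of read-outs of the history space
# (cell `pub-balaban`, T⁴ fan-out, `HOME/BINDER-OWNERS.md` row NE5, owner lineage t4-ne5-p1, gen 30; the ≤ 15-line follower of
# `InsertionLinearRate.ne5_above_max_of_model_reach_linear` that the retiring P2 seat waived to the owner, journal l.11766)

HONEST FRAMING (T4-DAG PAGE 1).  Rung (B)+1 on ONE finite four-torus — NOT infinite volume, NOT a mass gap, NOT the Clay problem; NE5 is NOT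
PRINTED and NOT PROVED (spine 0/9).  Nothing of Bałaban's series is asserted; 0 cite tags.  HONEST DEPENDENCY (cell, verbatim): continuum YM
on T⁴ ⇐ BetaPertH ∧ nine spine estimates (0/9 proved); BetaPertH ⇐ (D1) ∧ (D4) ∧ CAP+tail; G-an2-4 gates asym, D1 and NE2/3/4.

WHAT THIS MODULE IS.  `ne5_above_max_of_model_reach_linearLoc` = `InsertionLinearRate.ne5_above_max_of_model_reach_linear` with its two
volume-extensive binders replaced by their per-read-out twins of `InsertionLinearClassLoc` — `hbudget : AgeBudgetLoc LA N W κ cg ω ρ` (W3)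
and `hvr : VecRateLoc LA LB N W κ δv θ ρ` (W4's vector rate) — plus `hρ : Norming ρ` (for the Hist of record: `norming_evalCLM`); every
other binder BY NAME and unchanged (term-model reading, MI-R, KP inflation, decay extraction, pin budget, levels, W1 `N.OperatorRate`,
`BaseRate`, the numeric census); SAME rate threshold, conclusion LITERALLY `∃ C₅, NE5 EA EB W κ θ′ C₅`.  Bookkeeping; no estimate; 0 sorry.
-/

open scoped BigOperators

namespace Summit.QuantumFields.BalabanUV.T4Continuum.InsertionLinearRateLoc

open Literature.MathematicalPhysics.QuantumFieldTheory.Balaban1983to89.T4OutputRate (Carriers Functional DecayBound NE5)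
open Literature.MathematicalPhysics.QuantumFieldTheory.Balaban1983to89.T4ActivityLipschitz (ClusterRep)
open Literature.MathematicalPhysics.QuantumFieldTheory.Balaban1983to89.T4ActivityRecursion (KPInflated)
open Literature.MathematicalPhysics.QuantumFieldTheory.Balaban1983to89.T4InputCauchyRateData (StepModel)
open Summit.QuantumFields.BalabanUV.T4Continuum.InsertionLinearClass (LinearInsertion)
open Summit.QuantumFields.BalabanUV.T4Continuum.InsertionLinearClass.LinearInsertion (Reads)
open Summit.QuantumFields.BalabanUV.T4Continuum.InsertionLinearRate.LinearPair (ReadsB BaseRate)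
open Summit.QuantumFields.BalabanUV.T4Continuum.InsertionLinearClassLoc
open Summit.QuantumFields.BalabanUV.T4Continuum.ActivityTermModel (TermFamily)
open Summit.QuantumFields.BalabanUV.T4Continuum.ActivityStepJunction (ReadsStep)

variable {C : Carriers} {Op Hist : Type*} [NormedAddCommGroup Op] [NormedSpace ℂ Op] [NormedAddCommGroup Hist]
  [NormedSpace ℂ Hist] {E : Type*}

variable {R : ClusterRep C}
variable {ι κ S Ω Ω₀ 𝒴 𝒞 : Type*} [Fintype ι] [Fintype κ] [MeasurableSpace Ω] [MeasurableSpace Ω₀] {J : Type*}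
  [DecidableEq ι] [DecidableEq κ] [DecidableEq 𝒞] (𝔉 : TermFamily R Op Hist ι κ S Ω Ω₀ 𝒴 𝒞 J)

/-- **END-T WITH THE INSERTION BINDERS READ FROM THE LINEAR CLASS PER READ-OUT** (ruling R22): route P2's
`ne5_above_max_of_model_reach_linear` with W3 ⇐ `AgeBudgetLoc` (`insScaleBound_of_ageBudgetLoc`) and W4 ⇐ `BaseRate ∧ VecRateLoc`
(`insertionRate_of_linearLoc`) along a norming family `ρ`; constants `cg`, `δv` are then PER READ-OUT (volume-uniform on a sup-normed
`Hist`).  Conclusion LITERALLY `∃ C₅, NE5 EA EB W κ θ′ C₅`. [folklore] -/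
theorem ne5_above_max_of_model_reach_linearLoc {N : StepModel C Op Hist} (hN : ReadsStep 𝔉.model N)
    {EA : Functional C C.BgA} {EB : Functional C C.BgB} {W : Set (ℕ → ℝ)}
    {LA LB : LinearInsertion C Hist} (hLA : Reads LA N W) (hLB : ReadsB LB N W) (hdom : ∀ k, LA.dom k = LB.dom k)
    {ρ : E → (Hist →L[ℂ] ℂ)} (hρ : Norming ρ)
    {m : (ℕ → ℝ) → C.BgB → R.P → ℝ} {a d : R.P → ℝ} {δX : C.Dom → ℝ}
    {A A₀ E₀ E₁ κ' θ δ δb δv c ω s Λop Λhist ρ₀ ρ₀' : ℝ}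
    (hwf : 𝔉.WellFormed W)
    (hsum : ∀ g ∈ W, ∀ (U : C.BgB) (X : C.Dom), ∀ γ ∈ R.vol X, ∑ i ∈ 𝔉.terms g U X γ, 𝔉.G Λop Λhist ρ₀ g U X γ i ≤ m g U γ)
    (hρ01 : ρ₀ ≤ 1)
    (hrep : R.Represents EA EB) (hreal : 𝔉.model.Realizes EA EB W) (hbase : 𝔉.model.InBase EB W)
    (hKP : KPInflated R W m s a d) (hdec : R.DecayExtract δX d) (hpin : R.PinBudget a δX A κ')
    (hdA : DecayBound EA W A₀ κ') (hdB : DecayBound EB W E₀ κ')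
    (hop : N.OperatorRate W δ θ)
    (hbr : BaseRate LA LB N W δb θ) (hvr : VecRateLoc LA LB N W κ' δv θ ρ) (hbudget : AgeBudgetLoc LA N W κ' c ω ρ)
    (hE₀ : 0 ≤ E₀) (hδb : 0 ≤ δb) (hδv : 0 ≤ δv)
    (hE₁ : 0 < E₁) (hA : 0 ≤ A) (hΛop : 0 < Λop) (hΛhist : 0 < Λhist) (hρle : max (Λhist / Λop) 1 * ρ₀' ≤ ρ₀)
    (hs : Λhist * ρ₀' < s) (hδ : 0 ≤ δ) (hθ : 0 ≤ θ) (hθ1 : θ < 1)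
    (hc : 0 ≤ c) (hω : 0 < ω) (hω1 : ω < 1) (hreach : c * (A₀ + E₀) / (1 - ω) < ρ₀')
    {θ' : ℝ} (hθ' : max θ (ω + A * Λhist / (s - Λhist * ρ₀') * c) < θ') :
    ∃ C₅, NE5 EA EB W κ' θ' C₅ :=
  ActivityStepJunction.TermFamily.ne5_above_max_of_model_reach_step 𝔉 hN hwf hsum hρ01 hrep hreal hbase hKP hdec hpin hdA hdB
    hop (insertionRate_of_linearLoc hρ hLA hLB hdom hbr hvr hE₀ hδv hθ) (LinearInsertion.insAffine_of_reads hLA)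
    (LinearInsertion.insBlind_of_reads hLA) (LinearInsertion.insHomog_of_reads hLA)
    (insScaleBound_of_ageBudgetLoc hρ hLA hbudget hc hω.le hE₁.le) hE₁ hA hΛop hΛhist hρle hs hδ
    (add_nonneg hδb (mul_nonneg hE₀ hδv)) hθ hθ1 hc hω hω1 hreach hθ'

end Summit.QuantumFields.BalabanUV.T4Continuum.InsertionLinearRateLoc
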